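import Summits.ValiantsHypothesis.ValiantsHypothesis.Theorems.BarrierLeverChowThinRowsBallColumns
import Literature.Barriers.ValiantsHypothesis.BDGIL24AffineInputsVP

/-!
# Route BarrierLever — items `ChowHitsThinRowPartitionMinors` (stmt-ValiantsHypothesis-20195) and
# `PartitionMinorsHitByVP` (stmt-ValiantsHypothesis-19717): their HAMMING-BALL slices of the pair layer

Helper file (`--supports stmt-ValiantsHypothesis-20195`; cell valiant-natproofs, rung V4, 𝒟-side of
door (c); prover seat val-np-p8 gen 2).  Closes NO item; imports `…ChowThinRowsBallColumns` (val-np-p8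
g2, `chowHits_thinRows_ballColumns`) and the route-independent Literature module
`Literature.Barriers.ValiantsHypothesis.BDGIL24AffineInputsVP` (`SmallCircuits`,
`BergEtAl2024.complexity_le_of_totalDegree_le_one`, `complexity_finset_prod_le`); no definitions, no
route file in the import cone.  Pattern of `…ChowThinRowsStarColumnsSlice`.

* `chowHitsThinRowPartitionMinors_ballColumns` — item 20195's statement VERBATIM with the extra
  hypotheses: some row is empty, and the columns lie in a radius-`1` Hamming ball around a base point
  `p` with an unused inward direction (threshold `h₀ = 1`); contains the stars (`p = ∅`) and the
  co-weight-`≤ 1` CO-STARS.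
* `partitionMinorsHitByVP_thinRows_ballColumns` — item 19717's statement VERBATIM restricted to the same
  layouts (`b = 3`, `h₀ = 2`): every such partition minor is hit by a small circuit, unconditionally.

WHAT THIS IS NOT: rows without the empty row / columns outside a radius-1 ball are not covered; items
20195 / 20172 / 19717 are NOT proved; nothing on crux stmt-ValiantsHypothesis-14610 or `VP` versus `VNP`.
-/

set_option linter.dupNamespace false

namespace Summit.ValiantsHypothesis.ValiantsHypothesis.Theorems.BarrierLever.ChowSubcube

open MvPolynomial Literature.Barriers.ValiantsHypothesis Literature.Computability.AlgebraicComplexity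

/-- **Hamming-ball slice of item 20195**: item `ChowHitsThinRowPartitionMinors` verbatim, with the extra
hypotheses «some row is `∅`» and «the columns lie in a radius-1 ball around `p` with an unused inward
direction» — holds with `h₀ = 1`. -/
theorem chowHitsThinRowPartitionMinors_ballColumns :
    ∃ h₀ : ℕ, ∀ h : ℕ, h₀ ≤ h → ∀ (r : ℕ) (u w : Fin r → Finset (Fin h)),
      Function.Injective u → Function.Injective w → (∀ i, (u i).card ≤ 2) →
        (∃ i₀, u i₀ = ∅) → ∀ p : Finset (Fin h),
        (∀ j, w j = p ∨ ∃ c, (c ∉ p ∧ w j = insert c p) ∨ (c ∈ p ∧ w j = p.erase c)) →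
        (∃ c₀ : Fin h, c₀ ∉ p ∨ ∀ j, w j ≠ p.erase c₀) →
        ∃ ℓ : Fin (h + h) → MvPolynomial (Fin (h + h)) ℂ, (∀ k, (ℓ k).totalDegree ≤ 1) ∧
          (Matrix.of fun i j : Fin r => MvPolynomial.coeff
            (∑ a ∈ u i, Finsupp.single (Fin.castAdd h a) 1 +
              ∑ c ∈ w j, Finsupp.single (Fin.natAdd h c) 1) (∏ k, ℓ k)).det ≠ 0 :=
  ⟨1, fun h hh r u w hu hw hu2 h0 p hball hroom =>
    chowHits_thinRows_ballColumns h hh r u w hu hw hu2 h0 p hball hroom⟩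

/-- **Hamming-ball slice of item 19717, unconditionally**: item `PartitionMinorsHitByVP` verbatim
restricted to layouts whose rows have size `≤ 2` with one empty row and whose columns lie in a radius-1
Hamming ball (unused inward direction) — with `b = 3`, `h₀ = 2`, every such partition minor is hit by
some `f ∈ SmallCircuits ℂ (h+h) 3` (the product of affine forms of `chowHits_thinRows_ballColumns`).
[cite: ForbesShpilkaVolk2018, §8] -/
theorem partitionMinorsHitByVP_thinRows_ballColumns :
    ∃ b h₀ : ℕ, ∀ h : ℕ, h₀ ≤ h → ∀ (r : ℕ) (u w : Fin r → Finset (Fin h)),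
      Function.Injective u → Function.Injective w → (∀ i, (u i).card ≤ 2) →
        (∃ i₀, u i₀ = ∅) → ∀ p : Finset (Fin h),
        (∀ j, w j = p ∨ ∃ c, (c ∉ p ∧ w j = insert c p) ∨ (c ∈ p ∧ w j = p.erase c)) →
        (∃ c₀ : Fin h, c₀ ∉ p ∨ ∀ j, w j ≠ p.erase c₀) →
        ∃ f ∈ SmallCircuits ℂ (h + h) b,
          (Matrix.of fun i j : Fin r => MvPolynomial.coeff
            (∑ a ∈ u i, Finsupp.single (Fin.castAdd h a) 1 +
              ∑ c ∈ w j, Finsupp.single (Fin.natAdd h c) 1) f).det ≠ 0 := by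
  refine ⟨3, 2, fun h hh r u w hu hw hu2 h0 p hball hroom => ?_⟩
  obtain ⟨ℓ, hℓ, hdet⟩ := chowHits_thinRows_ballColumns h (by omega) r u w hu hw hu2 h0 p hball hroom
  have h3 : 3 ≤ h + h := by omega
  refine ⟨∏ k, ℓ k, ⟨?_, ?_⟩, hdet⟩
  · calc (∏ k, ℓ k).totalDegree ≤ ∑ k, (ℓ k).totalDegree := totalDegree_finsetProd _ _
      _ ≤ ∑ _k : Fin (h + h), 1 := Finset.sum_le_sum fun k _ => hℓ k
      _ = h + h := by simp
  · have hterm : ∀ k, complexity (ℓ k) ≤ 2 * (h + h) + 1 := fun k => by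
      simpa [Fintype.card_fin] using BergEtAl2024.complexity_le_of_totalDegree_le_one (hℓ k)
    calc complexity (∏ k, ℓ k)
        ≤ ∑ k, complexity (ℓ k) + (Finset.univ : Finset (Fin (h + h))).card :=
          complexity_finset_prod_le _ _
      _ ≤ ∑ _k : Fin (h + h), (2 * (h + h) + 1) + (h + h) := by
          rw [Finset.card_univ, Fintype.card_fin]
          exact Nat.add_le_add_right (Finset.sum_le_sum fun k _ => hterm k) _
      _ = (h + h) * (2 * (h + h) + 1) + (h + h) := by simp
      _ ≤ (h + h) ^ 3 := by
          have h2 : 3 * ((h + h) * (h + h)) ≤ (h + h) * ((h + h) * (h + h)) :=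
            Nat.mul_le_mul_right ((h + h) * (h + h)) h3
          calc (h + h) * (2 * (h + h) + 1) + (h + h) = 2 * ((h + h) * (h + h)) + 2 * (h + h) := by ring
            _ ≤ 3 * ((h + h) * (h + h)) := by nlinarith
            _ ≤ (h + h) * ((h + h) * (h + h)) := h2
            _ = (h + h) ^ 3 := by ring


/-- **CO-STARS (co-weight `≤ 1` points of a proper face), every height**: for a face `T ⊊ Fin h`,
all injective thin rows containing `∅` against injective columns among `T` and `T ∖ {c}` (`c ∈ T`) —
the «Leibniz columns» of planner valiant-natproofs-p1 g15's MEMO-normalforms §7.2, on which every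
pure-factor design is dead — are Chow-hit at every `h ≥ 1` (ball around `p = T`, inward directions
only; the unused coordinate `c₀ ∉ T` supplies the room hypothesis). -/
theorem chowHits_thinRows_costarColumns (h : ℕ) (hh : 1 ≤ h) (r : ℕ) (u w : Fin r → Finset (Fin h))
    (hu : Function.Injective u) (hw : Function.Injective w)
    (hu2 : ∀ i, (u i).card ≤ 2) (h0 : ∃ i₀, u i₀ = ∅) (T : Finset (Fin h)) (hT : ∃ c₀, c₀ ∉ T)
    (hW : ∀ j, w j = T ∨ ∃ c, c ∈ T ∧ w j = T.erase c) :
    ∃ ℓ : Fin (h + h) → MvPolynomial (Fin (h + h)) ℂ, (∀ k, (ℓ k).totalDegree ≤ 1) ∧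
      (Matrix.of fun i j : Fin r => MvPolynomial.coeff
        (∑ a ∈ u i, Finsupp.single (Fin.castAdd h a) 1 +
          ∑ c ∈ w j, Finsupp.single (Fin.natAdd h c) 1) (∏ k, ℓ k)).det ≠ 0 := by
  obtain ⟨c₀, hc₀⟩ := hT
  refine chowHits_thinRows_ballColumns h hh r u w hu hw hu2 h0 T (fun j => ?_) ⟨c₀, Or.inl hc₀⟩
  rcases hW j with e | ⟨c, hc, e⟩
  · exact Or.inl e
  · exact Or.inr ⟨c, Or.inr ⟨hc, e⟩⟩

end Summit.ValiantsHypothesis.ValiantsHypothesis.Theorems.BarrierLever.ChowSubcube
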